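import Literature.AnabelianGeometry.AbsoluteAnabelian.AbsTopIChains
import Literature.AnabelianGeometry.AbsoluteAnabelian.AbsTopI.SemiAbsoluteChainsSchema
import Literature.AnabelianGeometry.AbsoluteAnabelian.AbsTopII.CuspidalizationChains
import Literature.AnabelianGeometry.AbsoluteAnabelian.FreeProcyclicModel
import HarnessLib

/-!
# [AbsTopI] Def 4.2 (iii)/(v), Lemma 4.5 (iv): the three parametrised predicates of
# `AbsTopIChains.lean` — universal closures REFUTED, instance forms PROVED (proof-only companion)

S. Mochizuki, *Topics in Absolute Anabelian Geometry I: Generalities* (2012) [AbsTopI] §4, Def 4.2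
(iii) p. 49 (compatibility of an operation homomorphism with the rigidifying homomorphisms,
`ChainGroup.RigCompat`), Def 4.2 (v) p. 51 (the full subcategories `Chain(Π){−}` of chains whose
type-chain only contains the listed symbols, `PiChain.TypesAmong`), Lemma 4.5 (iv) p. 54 as amended in
[IUTchI] Rmk 1.2.2 (ii) p. 40 (the group-theoretic cuspidal criterion on a closed subgroup `I ⊆ H_*`,
`SatisfiesCuspidalCriterion`).

All three declarations are DEFINITIONS — predicates with free parameters (an operation homomorphism
`φ`; a chain `c` and a symbol set; a prime `l`, cusp-count data `d` and a subgroup `I`).  The print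
asserts none of them unconditionally; it USES them (as the compatibility clause of each elementary
operation, as the membership condition of `DLoc(Π)` / `ÉtLoc(Π)`, as the predicate whose maximal
elements are the cuspidal decomposition groups).  This file records, in the kernel:

* the universal closure of each predicate is FALSE (`not_forall_rigCompat`, `not_forall_typesAmong`,
  `not_forall_satisfiesCuspidalCriterion`), at an explicit NON-DEGENERATE model: the extension
  `1 → Δ → Π → G → 1` with `Π = Δ =` the slim pro-`2` group `ℤ_2 ⋊ (1 + 2ℤ_2)` of
  `SemiGraphs.WitnessIwahoriGroup` and `G = 1` (abc-iut-f-058's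
  `AbsTopI.exists_slim_fundamentalExtension`: the inputs `Π` slim, `Δ` slim, `Δ ≠ 1` of Def 4.2 are
  jointly satisfiable), the `Π`-chain `Π ⇝ Π` of length `1` and type `⋎`, and `I = 1 ⊆ ℤ_2` with
  `l = 2`;
* each predicate is SATISFIABLE / has the expected structural instances: `RigCompat` holds for the
  identity and is stable under composition (`ChainGroup.rigCompat_id`, `ChainGroup.rigCompat_comp`;
  transport along term isomorphisms is abc-iut-L4-t13's `AbsTopI.rigCompat_transfer`); `TypesAmong`
  is monotone, total for `Set.univ`, vacuous exactly for chains of length `0`, decided by the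
  type-chain (`PiChain.typesAmong_iff_forall_mem_typeChain`; invariance under chain isomorphisms is
  `AbsTopI.PiChainIsoOver.typesAmong_iff`); the cuspidal criterion holds for `I = H_* = ℤ_l` with
  the cusp-count data `d ≡ 0` ("one cusp on every covering": every proper characteristic open
  `J ⊊ ℤ_l` gives a totally ramified covering), via abc-iut's `isFreeProSigmaCyclic_singleton_padicInt`,
  and never for `I = 1` (`not_satisfiesCuspidalCriterion_bot`: `1 ≇ ℤ_l`); the model-relative
  content of Lemma 4.5 (iv) — "the decomposition groups of cusps are the maximal closed subgroups
  satisfying the criterion" — is abc-iut's `CuspInertiaData.isCuspidal_iff_isMaximalCuspidalCandidate`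
  (`AbsTopICuspInertiaOfPSCLem45iv.lean`), not restated here.

abc-iut cell bookkeeping: FACT-LIST rows F-0215 (`RigCompat`), F-0216 (`SatisfiesCuspidalCriterion`),
F-0217 (`TypesAmong`) are schema rows (R5): admissible AT NAMED INSTANCES only; this file is the
kernel certificate.  Proof-only (no `def`); the typer's file `AbsTopIChains.lean` is imported, not
edited.  Refuted-closure ≠ refuted-paper: the print states the instance forms.  Nothing here bears on
[IUTchIII] Cor 3.12; no side is taken.
-/

noncomputable section

open Topology
open scoped Pointwise

universe u

namespace Literature.AnabelianGeometry.AbsoluteAnabelian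

open Literature.AlgebraicGeometry.Frobenioids (IsSlimGroup)

namespace FundamentalExtension

/-! ### [AbsTopI] Def 4.2 (iii): `RigCompat` -/

namespace ChainGroup

variable {E : FundamentalExtension.{u}}

/-- The identity `Πⱼ → Πⱼ` is compatible with the rigidifying homomorphism of `Πⱼ` (on the whole
domain of `ρⱼ`). [cite: MochizukiAbsTopI2012, Def 4.2 (iii) p.49] -/
theorem rigCompat_id (L : E.ChainGroup) : RigCompat L L (ContinuousMonoidHom.id L.grp) :=
  ⟨L.dom, L.isOpen_dom, le_rfl, le_rfl, fun _ => rfl⟩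

/-- Compatibility with the rigidifying homomorphisms is stable under COMPOSITION of operation
homomorphisms `Πⱼ → Πⱼ₊₁ → Πⱼ₊₂` (intersect the two open subgroups of `Π`) — composites of
elementary operations stay rigidified, as the category `Chain(Π)` of Def 4.2 (iv) requires.
[cite: MochizukiAbsTopI2012, Def 4.2 (iii) p.49] -/
theorem rigCompat_comp {L L' L'' : E.ChainGroup} {φ : L.grp →ₜ* L'.grp} {ψ : L'.grp →ₜ* L''.grp}
    (hφ : RigCompat L L' φ) (hψ : RigCompat L' L'' ψ) : RigCompat L L'' (ψ.comp φ) := by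
  obtain ⟨U, hU, hUL, hUL', h⟩ := hφ
  obtain ⟨V, hV, hVL', hVL'', h'⟩ := hψ
  refine ⟨U ⊓ V, ?_, fun x hx => hUL (Subgroup.mem_inf.1 hx).1,
    fun x hx => hVL'' (Subgroup.mem_inf.1 hx).2, fun x => ?_⟩
  · rw [Subgroup.coe_inf]
    exact hU.inter hV
  · exact (congrArg ψ (h ⟨x, (Subgroup.mem_inf.1 x.2).1⟩)).trans
      (h' ⟨x, (Subgroup.mem_inf.1 x.2).2⟩)

/-- The compatibility predicate is NOT vacuous: in any extension satisfying the inputs of Def 4.2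
(`Π`, `Δ` slim, `Δ ≠ 1`) the TRIVIAL homomorphism `Π₀ → Π₀` is not compatible with the rigidifying
homomorphism of `Π₀ = Π` (compatibility on an open `U` would force `U = 1` to be open, whence
`Π = Z_Π(1) = 1` by slimness, contradicting `Δ ≠ 1`). [cite: MochizukiAbsTopI2012, Def 4.2 (iii) p.49] -/
theorem not_rigCompat_self_one (hP : IsSlimGroup E.arith) (hΔ : IsSlimGroup E.geom)
    (hne : E.geom ≠ ⊥) :
    ¬ RigCompat (ChainGroup.self hP hΔ hne) (ChainGroup.self hP hΔ hne) 1 := by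
  rintro ⟨U, hU, hU₁, hU₂, h⟩
  -- on `U` the trivial map agrees with the identity: `U = 1`
  have hUbot : U = ⊥ := by
    rw [eq_bot_iff]
    intro x hx
    have hx1 : (1 : E.arith) = x := h ⟨x, hx⟩
    exact Subgroup.mem_bot.2 hx1.symm
  subst hUbot
  -- `1` is open, so by slimness `Π = Z_Π(1)` is trivial, contradicting `Δ ≠ 1`
  have hc := hP.centralizer_eq_bot ⊥ hU
  apply hne
  rw [eq_bot_iff]
  intro x _
  have hx : x ∈ Subgroup.centralizer ((⊥ : Subgroup E.arith) : Set E.arith) := by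
    rw [Subgroup.mem_centralizer_iff]
    intro y hy
    rw [SetLike.mem_coe, Subgroup.mem_bot] at hy
    rw [hy, one_mul, mul_one]
  rwa [hc] at hx

/-- **The universal closure of `RigCompat` is FALSE** (FACT-LIST F-0215 is a schema, not a fact):
not every continuous homomorphism between terms of `Π`-chains is compatible with the rigidifying
homomorphisms — witness the trivial endomorphism of `Π₀ = Π` over the model extension of
abc-iut's `AbsTopI.exists_slim_fundamentalExtension`.  The print ASSUMES compatibility of each operation
homomorphism (Def 4.2 (iii) (a)–(d)); it does not assert it of arbitrary maps.
[cite: MochizukiAbsTopI2012, Def 4.2 (iii) p.49] -/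
theorem not_forall_rigCompat :
    ¬ ∀ (E : FundamentalExtension.{0}) (L L' : E.ChainGroup) (φ : L.grp →ₜ* L'.grp),
        RigCompat L L' φ := by
  intro h
  obtain ⟨E, hP, hΔ, hne⟩ := AbsTopI.exists_slim_fundamentalExtension
  exact not_rigCompat_self_one hP hΔ hne (h E _ _ 1)

end ChainGroup

/-! ### [AbsTopI] Def 4.2 (v): `TypesAmong` -/

namespace PiChain

variable {E : FundamentalExtension.{u}} {C : CuspidalData E} {hP : IsSlimGroup E.arith}
  {hΔ : IsSlimGroup E.geom} {hne : E.geom ≠ ⊥}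

/-- Every chain lies in `Chain(Π){⋏, ⋎, •, ⊚} = Chain(Π)` (all symbols allowed).
[cite: MochizukiAbsTopI2012, Def 4.2 (v) p.51] -/
theorem typesAmong_univ (c : E.PiChain C hP hΔ hne) : c.TypesAmong Set.univ :=
  fun _ => Set.mem_univ _

/-- `Chain(Π){A} ⊆ Chain(Π){B}` for `A ⊆ B` (the full subcategories are monotone in the symbol
set). [cite: MochizukiAbsTopI2012, Def 4.2 (v) p.51] -/
theorem TypesAmong.mono {c : E.PiChain C hP hΔ hne} {A B : Set ElemOpType} (h : c.TypesAmong A)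
    (hAB : A ⊆ B) : c.TypesAmong B :=
  fun j => hAB (h j)

/-- Membership in `Chain(Π){A}` is decided by the associated type-chain: every symbol occurring in
it lies in `A`. [cite: MochizukiAbsTopI2012, Def 4.2 (v) p.51] -/
theorem typesAmong_iff_forall_mem_typeChain (c : E.PiChain C hP hΔ hne) (A : Set ElemOpType) :
    c.TypesAmong A ↔ ∀ t ∈ c.typeChain, t ∈ A := by
  refine ⟨fun h t ht => ?_, fun h j => h _ ?_⟩
  · rw [PiChain.typeChain, List.mem_ofFn] at ht
    obtain ⟨j, rfl⟩ := ht
    exact h j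
  · rw [PiChain.typeChain, List.mem_ofFn]
    exact ⟨j, rfl⟩

/-- A chain of length `0` lies in every `Chain(Π){A}` (its type-chain is empty).
[cite: MochizukiAbsTopI2012, Def 4.2 (v) p.51] -/
theorem typesAmong_of_len_eq_zero (c : E.PiChain C hP hΔ hne) (h : c.len = 0)
    (A : Set ElemOpType) : c.TypesAmong A :=
  fun j => (Fin.cast h j).elim0

/-- `Chain(Π){∅}` consists exactly of the chains of length `0`.
[cite: MochizukiAbsTopI2012, Def 4.2 (v) p.51] -/
theorem typesAmong_empty_iff (c : E.PiChain C hP hΔ hne) : c.TypesAmong ∅ ↔ c.len = 0 := by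
  refine ⟨fun h => ?_, fun h => typesAmong_of_len_eq_zero c h _⟩
  by_contra hne0
  have hpos : 0 < c.len := Nat.pos_of_ne_zero hne0
  simpa using h ⟨0, hpos⟩

/-- The trivial chain `Π₀ = Π` (abc-iut's `AbsTopII.trivialChain`) lies in every `Chain(Π){A}`.
[cite: MochizukiAbsTopI2012, Def 4.2 (v) p.51] -/
theorem typesAmong_trivialChain (A : Set ElemOpType) :
    (AbsTopII.trivialChain C hP hΔ hne).TypesAmong A :=
  fun j => j.elim0

/-- The trivial chain is an object of `DLoc(Π) = Chain(Π){⋏, •}`.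
[cite: MochizukiAbsTopI2012, Def 4.2 (v) p.51] -/
theorem isDLocObj_trivialChain : (AbsTopII.trivialChain C hP hΔ hne).IsDLocObj :=
  typesAmong_trivialChain _

/-- The trivial chain is an object of `ÉtLoc(Π) = Chain(Π){⋏, ⋎}`.
[cite: MochizukiAbsTopI2012, Def 4.2 (v) p.51] -/
theorem isEtLocObj_trivialChain : (AbsTopII.trivialChain C hP hΔ hne).IsEtLocObj :=
  typesAmong_trivialChain _

/-- The subcategories are PROPER in general: over any extension satisfying the inputs of Def 4.2 and
any cuspidal data, the chain `Π ⇝ Π` of length `1` and type `⋎` (the identity quotient, abc-iut's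
`AbsTopII.isElemOp_finEtQuot_self`) is not an object of `DLoc(Π) = Chain(Π){⋏, •}`.
[cite: MochizukiAbsTopI2012, Def 4.2 (v) p.51] -/
theorem exists_not_isDLocObj (C : CuspidalData E) (hP : IsSlimGroup E.arith)
    (hΔ : IsSlimGroup E.geom) (hne : E.geom ≠ ⊥) :
    ∃ c : E.PiChain C hP hΔ hne, c.typeChain = [.finEtQuot] ∧ ¬ c.IsDLocObj := by
  let c : E.PiChain C hP hΔ hne :=
    { len := 1
      term := fun _ => ChainGroup.self hP hΔ hne
      term_zero := rfl
      types := fun _ => .finEtQuot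
      isElemOp := fun _ => AbsTopII.isElemOp_finEtQuot_self }
  refine ⟨c, rfl, fun h => ?_⟩
  have h0 := h ⟨0, Nat.one_pos⟩
  simp [c] at h0

/-- **The universal closure of `TypesAmong` is FALSE** (FACT-LIST F-0217 is a schema, not a fact):
not every chain lies in every `Chain(Π){A}` — witness the length-`1` chain `Π ⇝ Π` of type `⋎` over
the model extension of `AbsTopI.exists_slim_fundamentalExtension` (empty cuspidal data), `A = ∅`.
The print DEFINES the subcategories by this condition; it asserts no universal membership.
[cite: MochizukiAbsTopI2012, Def 4.2 (v) p.51] -/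
theorem not_forall_typesAmong :
    ¬ ∀ (E : FundamentalExtension.{0}) (C : CuspidalData E) (hP : IsSlimGroup E.arith)
        (hΔ : IsSlimGroup E.geom) (hne : E.geom ≠ ⊥) (c : E.PiChain C hP hΔ hne)
        (allowed : Set ElemOpType), c.TypesAmong allowed := by
  intro h
  obtain ⟨E, hP, hΔ, hne⟩ := AbsTopI.exists_slim_fundamentalExtension
  let C : CuspidalData E :=
    { Cusp := PEmpty.{1}
      Dcusp := fun x => x.elim
      Icusp := fun x => x.elim
      Icusp_eq := fun x => x.elim
      isClosed_Dcusp := fun x => x.elim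
      eq_of_conj := fun x => x.elim }
  obtain ⟨c, hc, -⟩ := exists_not_isDLocObj C hP hΔ hne
  have hlen : c.len = 0 := (typesAmong_empty_iff c).1 (h E C hP hΔ hne c ∅)
  have hlen' : c.typeChain.length = 0 := by rw [PiChain.typeChain, List.length_ofFn, hlen]
  rw [hc] at hlen'
  exact Nat.one_ne_zero hlen'

end PiChain

/-! ### [AbsTopI] Lemma 4.5 (iv) [amended, [IUTchI] Rmk 1.2.2 (ii)]: the cuspidal criterion -/

section Criterion

/-- A trivial group is not "`≅ ℤ_l`" (`l` prime): it has no open subgroup of index `l`, although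
`l` is an `{l}`-integer. [cite: MochizukiAbsTopI2012, Lemma 4.5 (iv) p.54] -/
theorem not_isFreeProSigmaCyclic_singleton_of_subsingleton {I : Type u} [Group I]
    [TopologicalSpace I] [Subsingleton I] {l : ℕ} (hl : l.Prime) :
    ¬ AbsTopII.IsFreeProSigmaCyclic {l} I := by
  intro h
  obtain ⟨H, -, hH⟩ := (h.isOpen_index_iff l).2
    ⟨hl.pos, fun p hp hpl => Set.mem_singleton_iff.2 ((Nat.prime_dvd_prime_iff_eq hp hl).1 hpl)⟩
  have htop : H = ⊤ := eq_top_iff.2 fun x _ => by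
    rw [Subsingleton.elim x 1]
    exact H.one_mem
  rw [htop, Subgroup.index_top] at hH
  exact hl.one_lt.ne hH

variable {Hstar : Type u} [Group Hstar] [TopologicalSpace Hstar] [IsTopologicalGroup Hstar]

/-- The trivial subgroup `I = 1 ⊆ H_*` never satisfies the cuspidal criterion (`l` prime; any
cusp-count data): its "`I ≅ ℤ_l`" conjunct fails. [cite: MochizukiAbsTopI2012, Lemma 4.5 (iv) p.54] -/
theorem not_satisfiesCuspidalCriterion_bot {l : ℕ} (hl : l.Prime) (d : CuspCountData Hstar) :
    ¬ SatisfiesCuspidalCriterion l d (⊥ : Subgroup Hstar) := fun h =>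
  not_isFreeProSigmaCyclic_singleton_of_subsingleton (I := ↥(⊥ : Subgroup Hstar)) hl h.2.1

/-- **The universal closure of `SatisfiesCuspidalCriterion` is FALSE** (FACT-LIST F-0216 is a
schema, not a fact): witness `H_* = ℤ_2`, `l = 2`, `I = 1`.  The print characterises the cuspidal
decomposition groups as the MAXIMAL closed subgroups satisfying the criterion (the model-relative
comparison is abc-iut's `CuspInertiaData.isCuspidal_iff_isMaximalCuspidalCandidate`); it does not
assert the criterion of every subgroup. [cite: MochizukiAbsTopI2012, Lemma 4.5 (iv) p.54] -/
theorem not_forall_satisfiesCuspidalCriterion :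
    ¬ ∀ (Hstar : Type) [Group Hstar] [TopologicalSpace Hstar] [IsTopologicalGroup Hstar]
        (l : ℕ) (d : CuspCountData Hstar) (I : Subgroup Hstar),
        SatisfiesCuspidalCriterion l d I := by
  haveI : Fact (Nat.Prime 2) := ⟨Nat.prime_two⟩
  intro h
  exact not_satisfiesCuspidalCriterion_bot (Hstar := Multiplicative ℤ_[2]) Nat.prime_two
    ⟨fun _ => 0⟩ (h _ 2 _ ⊥)

/-- The criterion is SATISFIABLE by its intended model: in `H_* = ℤ_l` (free pro-`{l}`-cyclic by
abc-iut's `isFreeProSigmaCyclic_singleton_padicInt`) the closed subgroup `I = H_*` with the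
cusp-count data `d ≡ 0` — "one cusp on every covering", so that for every proper characteristic open
`J ⊊ I·J = ℤ_l` the inequality `d(I^l·J) + 1 = 1 < l = l·(d(I·J) + 1)` records a totally ramified
covering — satisfies the criterion. [cite: MochizukiAbsTopI2012, Lemma 4.5 (iv) p.54] -/
theorem satisfiesCuspidalCriterion_top_padicInt (l : ℕ) [Fact l.Prime] :
    SatisfiesCuspidalCriterion (Hstar := Multiplicative ℤ_[l]) l ⟨fun _ => 0⟩ ⊤ := by
  refine ⟨?_, ?_, fun _ _ _ _ => ?_⟩
  · rw [Subgroup.coe_top]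
    exact isClosed_univ
  · let e : ↥(⊤ : Subgroup (Multiplicative ℤ_[l])) ≃ₜ* Multiplicative ℤ_[l] :=
      { Subgroup.topEquiv with
        continuous_toFun := continuous_subtype_val
        continuous_invFun := by
          apply Continuous.subtype_mk
          exact continuous_id }
    exact (isFreeProSigmaCyclic_singleton_padicInt l).of_continuousMulEquiv e.symm
  · show 0 + 1 < l * (0 + 1)
    simpa using (Fact.out : l.Prime).one_lt

/-- In the same model `I = H_* = ℤ_l` is (trivially) a MAXIMAL closed subgroup satisfying the
criterion, i.e. an output of the amended characterisation (`IsMaximalCuspidalCandidate`).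
[cite: MochizukiAbsTopI2012, Lemma 4.5 (iv) p.54] -/
theorem isMaximalCuspidalCandidate_top_padicInt (l : ℕ) [Fact l.Prime] :
    IsMaximalCuspidalCandidate (Hstar := Multiplicative ℤ_[l]) l ⟨fun _ => 0⟩ ⊤ :=
  ⟨satisfiesCuspidalCriterion_top_padicInt l, fun _ _ h => (top_le_iff.1 h).symm⟩

end Criterion

end FundamentalExtension

end Literature.AnabelianGeometry.AbsoluteAnabelian

end
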